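import Literature.AlgebraicGeometry.HodgeTheory.MiddleDimensionReductionHolds
import Summits.HodgeConjecture.HodgeConjecture.Theorems.SoloBlindMiddleDegree
import Summits.HodgeConjecture.HodgeConjecture.Statement
import HarnessLib

/-!
# The middle-degree instances of the summit form a chain: `MiddleHodge (m+1) → MiddleHodge m`

Solo-blind residency on `HodgeConjecture`, session s173; claims SB-C1336 – SB-C1338 of its
`CLAIMS.jsonl`, companion prose `work/s173/monotone.md`, front sheet `paper/sharpest.md` §1 (1h).

A KERNEL COROLLARY of theorems already in the tree, recorded at summit level. `MiddleHodge m`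
(`SoloBlindMiddleDegree`: every rational `(m,m)`-class on every smooth projective complex `2m`-fold is
algebraic) is **antitone in `m`**: the Hodge conjecture in the middle degree of `(2m+2)`-folds implies
it in the middle degree of `2m`-folds. Proof (the two halves of Brosnan–Fang–Nie–Pearlstein's
Lemma 48, each used ONCE and at a FIXED auxiliary variety, instead of for all `m` at once): for a
rational `(m,m)`-class `c` on the `2m`-fold `X`,

* (`ℙ¹`-step, pull-backs only; the tree's `mem_algebraicClasses_of_projectiveLine_of_preservesHodgeType`)
  `c` is algebraic as soon as every rational `(m,m)`-class `κ` on the `(2m+1)`-fold `X × ℙ¹` is: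
  `c = s_t^* pr₁^* c` for a general complex point `t` of `ℙ¹`;
* (product step with `r = 1`; the proof of the tree's
  `mem_algebraicClasses_of_two_mul_add_eq_of_cupPreservesHodgeType` with its hypothesis "the middle
  degree of ALL even-dimensional varieties" replaced by the one instance it uses, here
  `mem_algebraicClasses_of_middle_of_prod_projectiveSpace`) such a `κ` is algebraic as soon as every
  rational `(m+1,m+1)`-class on the `(2m+2)`-fold `(X × ℙ¹) × ℙ¹` is:
  `κ = λ⁻¹ pr_{1*}(pr₁^* κ ∪ pr₂^* ρ)`, `ρ` the point class of the second `ℙ¹`.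

Consequences (`middleHodge_of_le`, `hodgeConjecture_iff_frequently_middleHodge`,
`hodgeConjecture_iff_eventually_middleHodge`, `not_middleHodge_of_le`): the truth values of
`MiddleHodge 0, MiddleHodge 1, MiddleHodge 2, …` are `true` up to a threshold `m* ∈ {1, 2, …} ∪ {∞}`
and `false` beyond it (`MiddleHodge 0`, `MiddleHodge 1` are theorems: `middleHodge_of_le_one`); the
Hodge conjecture is the statement `m* = ∞`, equivalently "`MiddleHodge m` for infinitely many `m`",
equivalently "for all large `m`"; and a counterexample in some even dimension `2m` propagates to every
even dimension `≥ 2m` — the fourfold case `m = 2` is the WEAKEST open instance, not merely the first.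

What it buys (bookkeeping, not a reduction of difficulty): any strategy proving the middle-degree
Hodge conjecture only in sufficiently large (or along any infinite set of) even dimensions proves the
summit; conversely no even dimension `2m ≥ 4` is easier than the fourfold case.

## References

* [BrosnanFangNiePearlstein2009] P. Brosnan, H. Fang, Z. Nie, G. Pearlstein, Singularities of
  admissible normal functions, Invent. Math. 177 (2009), §6 Lemma 48 (arXiv:0711.0964, p. 13).
* [VoisinHodgeI2002] C. Voisin, Hodge Theory and Complex Algebraic Geometry I (2002), §7.3.2, §11.1.2.
* [Deligne2000] P. Deligne, The Hodge conjecture, Clay problem description (2000), §1.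
-/

noncomputable section

open scoped Manifold ContDiff
open CategoryTheory CategoryTheory.Limits AlgebraicGeometry MonoidalCategory CartesianMonoidalCategory
open Literature.AlgebraicGeometry Literature.AlgebraicGeometry.Motives
open Literature.AlgebraicGeometry.HodgeTheory
open Literature.AlgebraicTopology.SingularHomology

namespace Summit.HodgeConjecture.HodgeConjecture.Theorems.SoloBlind

/-- **The product step of BFNP Lemma 48 at a fixed auxiliary variety.** Let `X` be smooth projective
of dimension `n = 2p + r`, `r ≥ 1`, and `c ∈ H²ᵖ(X(ℂ); ℂ)` a rational `(p, p)`-class; suppose every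
rational `(p + r, p + r)`-class in the middle degree of the `2(p+r)`-fold `X × ℙʳ` is algebraic. Then
`c` is algebraic: with `ρ ≠ 0` a rational top-degree class of `ℙʳ`, `c' = pr₁^* c ∪ pr₂^* ρ` is a
rational middle-degree Hodge class of `X × ℙʳ`, hence algebraic, and `pr_{1*} c' = λ c` with `λ ≠ 0`.
This is the tree's `mem_algebraicClasses_of_two_mul_add_eq_of_cupPreservesHodgeType` (same proof,
verbatim) with its hypothesis "every rational middle-degree Hodge class on EVERY even-dimensional
smooth projective variety is algebraic" weakened to the single instance `X × ℙʳ` that the proof uses.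
[cite: BrosnanFangNiePearlstein2009, §6 Lemma 48 (proof, case dim Y < 2k)]
[cite: VoisinHodgeI2002, §7.3.2 and §11.1.2] -/
theorem mem_algebraicClasses_of_middle_of_prod_projectiveSpace
    (hI : hodgePQ_independent_of_hodgeModel)
    (hA : ∀ ⦃n : ℕ⦄ ⦃X : Motives.SchemeOver ℂ⦄, nonempty_hodgeModel n X)
    (hcup : ∀ ⦃n : ℕ⦄ ⦃X : Motives.SchemeOver ℂ⦄, Motives.IsSmoothProjective n X →
      CupPreservesHodgeType n X)
    {n : ℕ} {X : Motives.SchemeOver ℂ} (hX : Motives.IsSmoothProjective n X) {p r : ℕ}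
    (hr : 2 * p + r = n) (hr1 : 1 ≤ r)
    (hmid : ∀ c' : complexBetti (X ⊗ Motives.projectiveSpace r ℂ) (2 * (p + r)), IsRationalClass c' →
      IsOfHodgeType (2 * (p + r)) (X ⊗ Motives.projectiveSpace r ℂ) (2 * (p + r)) (p + r) (p + r) c' →
        c' ∈ algebraicClasses (X ⊗ Motives.projectiveSpace r ℂ) (p + r))
    (c : complexBetti X (2 * p)) (hc : IsRationalClass c)
    (hpp : IsOfHodgeType n X (2 * p) p p c) : c ∈ algebraicClasses X p := by
  -- an orientation family (orientations of the closed manifolds `Y(ℂ)` exist) and its duality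
  let μ : OrientationFamily := fun n Y hY ↦ (Motives.ComplexPoints.isOrientableOver ℂ hY).some
  have hμ : μ.HasPoincareDuality := OrientationFamily.hasPoincareDuality μ
  have hS := gysinMap_restrictCompl_eq_zero_of_field.{0, 0} ℂ
  -- the auxiliary factor `P = ℙʳ`, a complex point `t`, the even-dimensional `V = X × P`
  set P := Motives.projectiveSpace r ℂ with hPdef
  have hP : Motives.IsSmoothProjective r P := Motives.isSmoothProjective_projectiveSpace_holds ℂ r
  haveI := connectedSpace_complexPoints hP
  obtain ⟨t⟩ : Nonempty (Motives.ComplexPoints P) := inferInstance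
  haveI := connectedSpace_complexPoints hX
  obtain ⟨x₀⟩ : Nonempty (Motives.ComplexPoints X) := inferInstance
  have hV : Motives.IsSmoothProjective (n + r) (X ⊗ P) := Motives.IsSmoothProjective.tensor_holds hX hP
  haveI : LocallyOfFiniteType P.hom := locallyOfFiniteType_of_isSmoothProjective hP
  haveI : IsClosedImmersion (Motives.sliceAt X t).left := Motives.isClosedImmersion_sliceAt_left t
  haveI := pathConnectedSpace_complexPoints hX
  -- a non-zero rational top-degree class `ρ` on `P`, of type `(r, r)`
  obtain ⟨ρ, hρ, hρ0⟩ := exists_isRationalClass_ne_zero_of_degree_eq_two_mul hP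
  obtain ⟨B⟩ := (hA (n := r) (X := P)).nonempty hP
  have hρtyp : IsOfHodgeType r P (2 * r) r r ρ := isOfHodgeType_of_degree_eq_two_mul B ρ
  -- `pr₂^* ρ` dies off the slice `s_t(X) = pr₂⁻¹(t)` …
  have hρsupp : complexBetti.restrictCompl (X ⊗ P) (Set.range (Motives.sliceAt X t).left.base)
      (2 * r) (complexBetti.map (snd X P) (2 * r) ρ) = 0 := by
    rw [range_sliceAt_left_base]
    exact complexBetti.restrictCompl_map_eq_zero (snd X P) (restrictCompl_pt_eq_zero hP hr1 t ρ)
  -- … hence is a Gysin image `s_{t*} y`, `y ∈ H⁰(X(ℂ); ℂ) = ℂ · 1`: `pr₂^* ρ = λ · s_{t*} 1`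
  obtain ⟨y, hy⟩ := exists_complexGysin_eq_of_isClosedImmersion μ hV hX (Motives.sliceAt X t)
    (show 0 + 2 * (n + r) = 2 * r + 2 * n by ring) hρsupp
  obtain ⟨lam, rfl⟩ := singularCohomology.exists_eq_smul_one y
  rw [map_smul] at hy
  -- `λ ≠ 0`: `pr₂^*` is injective (`pr₂` has the section `(x₀, 𝟙)`) and `ρ ≠ 0`
  have hlam : lam ≠ 0 := by
    rintro rfl
    rw [zero_smul] at hy
    apply hρ0
    let j : P ⟶ X ⊗ P := CartesianMonoidalCategory.lift (Motives.toSpecOver P ≫ x₀) (𝟙 P)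
    have hj : j ≫ snd X P = 𝟙 P := CartesianMonoidalCategory.lift_snd _ _
    have hρj : complexBetti.map j (2 * r) (complexBetti.map (snd X P) (2 * r) ρ) = ρ := by
      rw [← CategoryTheory.comp_apply, ← complexBetti.map_comp, hj, complexBetti.map_id,
        CategoryTheory.id_apply]
    rw [← hρj, ← hy, map_zero]
  -- the middle-degree class `c' = pr₁^* c ∪ pr₂^* ρ` on `V`: rational, of type `(p + r, p + r)`
  set c' : complexBetti (X ⊗ P) (2 * (p + r)) :=
    cupProduct (show 2 * p + 2 * r = 2 * (p + r) by ring) (complexBetti.map (fst X P) (2 * p) c)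
      (complexBetti.map (snd X P) (2 * r) ρ) with hc'def
  have hc'rat : IsRationalClass c' := (hc.map _).cup _ (hρ.map _)
  have hc'typ : IsOfHodgeType (n + r) (X ⊗ P) (2 * (p + r)) (p + r) (p + r) c' :=
    hcup hV _ (preservesHodgeType_of_nonempty_hodgeModel hI (hA (X := X ⊗ P)) hV hX (fst X P) hpp)
      (preservesHodgeType_of_nonempty_hodgeModel hI (hA (X := X ⊗ P)) hV hP (snd X P) hρtyp)
  -- `V` has the even dimension `n + r = 2(p + r)`: `c'` is algebraic by hypothesis
  have hdim : n + r = 2 * (p + r) := by omega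
  rw [hdim] at hc'typ
  have halg : c' ∈ algebraicClasses (X ⊗ P) (p + r) := hmid c' hc'rat hc'typ
  -- `pr_{1*} c' ∈ Nᵖ H²ᵖ(X(ℂ); ℂ)` (Gysin maps and supports)
  have hpush : complexGysin μ hV hX (fst X P) (show 2 * (p + r) + 2 * n = 2 * p + 2 * (n + r) by ring)
      c' ∈ algebraicClasses X p :=
    complexGysin_mem_supportedClasses hS μ hμ hV hX (fst X P) _ (by omega) halg
  -- `pr_{1*} c' = c ∪ pr_{1*} pr₂^* ρ = c ∪ λ · (s_t ≫ pr₁)_* 1 = λ c`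
  have hone : complexGysin μ hV hX (fst X P) (show 2 * r + 2 * n = 0 + 2 * (n + r) by ring)
      (complexBetti.map (snd X P) (2 * r) ρ) = lam • singularCohomology.one ℂ (Motives.ComplexPoints X) := by
    rw [← hy, map_smul, ← LinearMap.comp_apply,
      ← complexGysin_comp hμ hX hV hX (Motives.sliceAt X t) (fst X P)]
    simp only [Motives.sliceAt_fst]
    rw [complexGysin_id hμ hX 0, LinearMap.id_apply]
  have hcc : complexGysin μ hV hX (fst X P) (show 2 * (p + r) + 2 * n = 2 * p + 2 * (n + r) by ring)
      c' = lam • c := by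
    rw [hc'def, complexGysin_cup hμ hV hX (fst X P) _ _
      (show 2 * r + 2 * n = 0 + 2 * (n + r) by ring) (Nat.add_zero (2 * p)), hone,
      LinearMap.map_smul, cupProduct_one]
  rw [hcc] at hpush
  have h := Submodule.smul_mem _ lam⁻¹ hpush
  rwa [smul_smul, inv_mul_cancel₀ hlam, one_smul] at h

/-- The three named facts feeding the two halves of BFNP Lemma 48 are theorems of the tree: Hodge
models exist (`nonempty_hodgeModel_holds`), `H^{p,q}` is model-independent
(`hodgePQ_independent_of_hodgeModel_holds`), cup products respect Hodge types
(`cupPreservesHodgeType_of_nonempty_hodgeModel` fed with de Rham's theorem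
`Literature.NumberTheory.Transcendental.exists_deRhamIsoFamily_holds`). Packaged once.
[cite: VoisinHodgeI2002, §7.3.2] -/
theorem cupPreservesHodgeType_holds' {n : ℕ} {X : Motives.SchemeOver ℂ}
    (hX : Motives.IsSmoothProjective n X) : CupPreservesHodgeType n X :=
  cupPreservesHodgeType_of_nonempty_hodgeModel hodgePQ_independent_of_hodgeModel_holds
    nonempty_hodgeModel_holds
    (fun E _ _ _ ↦ Literature.NumberTheory.Transcendental.exists_deRhamIsoFamily_holds E) hX

/-- **Monotonicity of the middle-degree Hodge conjecture**: `MiddleHodge (m + 1) → MiddleHodge m` —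
the Hodge conjecture for rational `(m+1, m+1)`-classes on `(2m+2)`-folds implies it for rational
`(m, m)`-classes on `2m`-folds. For `c` on the `2m`-fold `X`: by the `ℙ¹`-step
(`mem_algebraicClasses_of_projectiveLine_of_preservesHodgeType`, `c = s_t^* pr₁^* c`) it suffices to
treat rational `(m,m)`-classes `κ` on the `(2m+1)`-fold `X × ℙ¹`, and by the product step with
`r = 1` (`mem_algebraicClasses_of_middle_of_prod_projectiveSpace`, `κ = λ⁻¹ pr_{1*}(pr₁^*κ ∪ pr₂^*ρ)`)
those are algebraic once the rational `(m+1,m+1)`-classes of the `(2m+2)`-fold `(X × ℙ¹) × ℙ¹` are.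
[cite: BrosnanFangNiePearlstein2009, §6 Lemma 48] [cite: VoisinHodgeI2002, §7.3.2] -/
theorem middleHodge_of_succ {m : ℕ} (h : MiddleHodge (m + 1)) : MiddleHodge m := by
  intro X hX c hc hpp
  have hP : Motives.IsSmoothProjective 1 (Motives.projectiveSpace 1 ℂ) :=
    Motives.isSmoothProjective_projectiveSpace_holds ℂ 1
  have hXP : Motives.IsSmoothProjective (2 * m + 1) (X ⊗ Motives.projectiveSpace 1 ℂ) :=
    Motives.IsSmoothProjective.tensor_holds hX hP
  refine mem_algebraicClasses_of_projectiveLine_of_preservesHodgeType hX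
    (preservesHodgeType_of_nonempty_hodgeModel hodgePQ_independent_of_hodgeModel_holds
      nonempty_hodgeModel_holds hXP hX (fst X (Motives.projectiveSpace 1 ℂ)))
    (fun κ hκ hκpp ↦ ?_) c hc hpp
  refine mem_algebraicClasses_of_middle_of_prod_projectiveSpace hodgePQ_independent_of_hodgeModel_holds
    (fun _ _ ↦ nonempty_hodgeModel_holds) (fun _ _ hY ↦ cupPreservesHodgeType_holds' hY) hXP
    (p := m) (r := 1) (by ring) le_rfl (fun c' hc' hc'pp ↦ ?_) κ hκ hκpp
  -- `(X × ℙ¹) × ℙ¹` is smooth projective of dimension `2m + 2 = 2(m + 1)`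
  have hV := Motives.IsSmoothProjective.tensor_holds hXP hP
  have e : 2 * m + 1 + 1 = 2 * (m + 1) := by ring
  rw [e] at hV
  exact h hV c' hc' hc'pp

/-- `MiddleHodge` is antitone: `m ≤ m' → MiddleHodge m' → MiddleHodge m` (iterate
`middleHodge_of_succ`). [cite: BrosnanFangNiePearlstein2009, §6 Lemma 48] -/
theorem middleHodge_of_le {m m' : ℕ} (hmm' : m ≤ m') (h : MiddleHodge m') : MiddleHodge m := by
  induction hmm' with
  | refl => exact h
  | step _ ih => exact ih (middleHodge_of_succ h)

/-- A counterexample propagates upward: if the middle-degree Hodge conjecture fails for `2m`-folds it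
fails for `2m'`-folds for every `m' ≥ m`. [cite: BrosnanFangNiePearlstein2009, §6 Lemma 48] -/
theorem not_middleHodge_of_le {m m' : ℕ} (hmm' : m ≤ m') (h : ¬ MiddleHodge m) : ¬ MiddleHodge m' :=
  fun h' ↦ h (middleHodge_of_le hmm' h')

/-- **The summit from infinitely many dimensions**: `HodgeConjecture ↔ ∀ m₀, ∃ m ≥ m₀, MiddleHodge m`
— the Hodge conjecture holds if (and only if) its middle-degree instance holds in infinitely many
even dimensions. [cite: BrosnanFangNiePearlstein2009, §6 Lemma 48] [cite: Deligne2000, §1] -/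
theorem hodgeConjecture_iff_frequently_middleHodge :
    _root_.HodgeConjecture ↔ ∀ m₀ : ℕ, ∃ m, m₀ ≤ m ∧ MiddleHodge m := by
  refine ⟨fun h m₀ ↦ ⟨m₀, le_rfl, middleHodge_of_hodgeConjecture h m₀⟩, fun h ↦ ?_⟩
  refine hodgeConjecture_of_forall_middleHodge fun m ↦ ?_
  obtain ⟨m', hmm', hm'⟩ := h m
  exact middleHodge_of_le hmm' hm'

/-- **The summit from all large dimensions**: `HodgeConjecture ↔ ∃ m₀, ∀ m ≥ m₀, MiddleHodge m`.
[cite: BrosnanFangNiePearlstein2009, §6 Lemma 48] [cite: Deligne2000, §1] -/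
theorem hodgeConjecture_iff_eventually_middleHodge :
    _root_.HodgeConjecture ↔ ∃ m₀ : ℕ, ∀ m, m₀ ≤ m → MiddleHodge m := by
  refine ⟨fun h ↦ ⟨0, fun m _ ↦ middleHodge_of_hodgeConjecture h m⟩, fun ⟨m₀, h⟩ ↦ ?_⟩
  exact hodgeConjecture_iff_frequently_middleHodge.mpr fun m₁ ↦
    ⟨max m₀ m₁, le_max_right _ _, h _ (le_max_left _ _)⟩

/-- **The fourfold case is the weakest open instance**: for every `m ≥ 2`, the middle-degree Hodge
conjecture for `2m`-folds implies it for fourfolds (`(2,2)`-classes).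
[cite: BrosnanFangNiePearlstein2009, §6 Lemma 48] -/
theorem middleHodge_two_of_two_le {m : ℕ} (hm : 2 ≤ m) (h : MiddleHodge m) : MiddleHodge 2 :=
  middleHodge_of_le hm h

end Summit.HodgeConjecture.HodgeConjecture.Theorems.SoloBlind

end
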